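import Summits.AnomalousDissipation.AnomalousDissipation.Theorems.SoloBlindMomentumFluxMeans

/-!
# Solo (blind) — in-phase pinning under exactly `ZerothLaw`'s hypotheses

`SoloBlindMomentumFluxMeans` pins the long-time in-phase Reynolds-stress moment
`A(t) = ∫ u₁u₃ sin(2πx₃)` of Leray–Hopf solutions of the Kolmogorov-forced system under a POINTWISE
energy bound `∫‖u(t)‖² ≤ R`. Here the pointwise bound is removed: the only inputs are the clauses
of `ZerothLaw` itself — a global Leray–Hopf solution `u` of `NS_ν(kolForce)` (`ν > 0`) with an `L²`
(nothing is assumed on the datum beyond the Leray–Hopf energy inequality), its `limsup`-Cesàro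
energy bound `meanEnergy u ≤ E` and a floor `ε ≤ meanDissipation ν u`.
The two technical inputs are the tree's Doering–Foias bounds for Leray–Hopf solutions
(`Torus.IsGlobalLerayHopf.timeMean_norm_sq_le`: Cesàro energy bounded for `T ≥ 1`;
`Torus.IsGlobalLerayHopf.abs_timeMean_power_le`: `|⟨W⟩_T| ≤ ‖f‖ √⟨‖u‖²⟩_T`) and the Leray–Hopf
energy inequality, which make the boundary term `T⁻¹(W(T) − W(0))` of the Cesàro work identity
tend to zero WITHOUT any uniform-in-time hypothesis (`‖u(T)‖² ≤ ‖u₀‖² + O(T)`).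

Results (`W = ∫⟪f,u⟫`, `⟨·⟩_T = timeMean · T`):
* `eventually_abs_boundary_le`: `T⁻¹ |W(T) − W(0)| → 0` along every global Leray–Hopf solution;
* `meanPower_kolForce_eq_inphase'` (exact, hypothesis-free):
  `meanPower f u = (½ − 2π · longTimeAvgInf A)/(4π²ν)`, i.e. `2πν·⟨W⟩ = 1/(4π) − liminf_T ⟨A⟩_T`;
* `inphase_longTimeAvgInf_le_of_floor'`: `ε ≤ meanDissipation ν u ⟹ liminf_T ⟨A⟩_T ≤ 1/(4π) − 2πνε`;
* `inphase_longTimeAvg_bounds_of_meanEnergy`: `meanEnergy u ≤ E ⟹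
  1/(4π) − 2πν√(E/2) ≤ liminf_T ⟨A⟩_T ≤ limsup_T ⟨A⟩_T ≤ 1/(4π) + 2πν√(E/2)`;
* `zerothLaw_clauses_pin_inphase`: both together.
So every `ZerothLaw` witness family on the Kolmogorov force (energy `≤ E`, floor `ε`) is a family
of Leray–Hopf solutions whose `liminf` Cesàro in-phase flux sits in the window
`[1/(4π) − 2πν_j√(E/2), 1/(4π) − 2πν_jε]` for every `j`; conversely the upper un-pinning bound
is EQUIVALENT to the floor `ε ≤ meanPower f u_j` (`= meanDissipation` for energy-equality
solutions, `≥` in general), while the lower bound is implied by, not equivalent to, the energy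
clause. [folklore; cite: DoeringFoias2002, §2; cite: MusacchioBoffetta2014, §2 eq. (2.4)]
-/

open MeasureTheory Filter Topology Set UnitAddTorus
open scoped ENNReal NNReal InnerProductSpace

noncomputable section

namespace Summit.AnomalousDissipation.AnomalousDissipation.Theorems

open Literature.Analysis.FunctionSpaces Literature.Analysis.FunctionSpaces.Torus
open Literature.Analysis.FluidPDE

variable {ν : ℝ} {u₀ : UnitAddTorus (Fin 3) → EuclideanSpace ℝ (Fin 3)}
  {u : ℝ → UnitAddTorus (Fin 3) → EuclideanSpace ℝ (Fin 3)}

/-- The Cesàro means `T ↦ T⁻¹ ∫₀ᵀ ∫‖u‖²` of the energy (`meanEnergy u` is their `limsup`).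
[folklore] -/
def energyMean (u : ℝ → UnitAddTorus (Fin 3) → EuclideanSpace ℝ (Fin 3)) : ℝ → ℝ :=
  timeMean fun t => ∫ x, ‖u t x‖ ^ 2

/-- **Slice energy from the Leray–Hopf energy inequality**: `∫‖u(T)‖² ≤ ∫‖u₀‖² + 2T·⟨W⟩_T`
for every `T > 0` (`ν ≥ 0`). [folklore; cite: Leray1934, (5.2)] -/
theorem lh_norm_sq_le (hu : Torus.IsGlobalLerayHopf ν (fun _ => kolForce) u₀ u) (hν : 0 ≤ ν)
    {T : ℝ} (hT : 0 < T) :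
    ∫ x, ‖u T x‖ ^ 2 ≤ (∫ x, ‖u₀ x‖ ^ 2) + 2 * T * powerMean u T := by
  have h := (hu T hT).energy_ineq_zero T ⟨hT.le, le_rfl⟩
  simp only [Torus.kineticEnergy] at h
  have hD : 0 ≤ ν * (∫⁻ τ in Ioo 0 T, Torus.eGradNormSq (u τ)).toReal :=
    mul_nonneg hν ENNReal.toReal_nonneg
  have hP : ∫ τ in (0 : ℝ)..T, ∫ x, ⟪kolForce x, u τ x⟫_ℝ = T * powerMean u T := by
    unfold powerMean timeMean
    rw [← mul_assoc, mul_inv_cancel₀ hT.ne', one_mul]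
  linarith

/-- **Cesàro power against Cesàro energy**: `|⟨W⟩_T| ≤ √(1/2) √⟨‖u‖²⟩_T` (`‖f‖_{L²} = √(1/2)`;
the tree's `Torus.IsGlobalLerayHopf.abs_timeMean_power_le`). [cite: DoeringFoias2002, §2] -/
theorem abs_powerMean_le (hu : Torus.IsGlobalLerayHopf ν (fun _ => kolForce) u₀ u) {T : ℝ}
    (hT : 0 < T) : |powerMean u T| ≤ Real.sqrt (1 / 2) * Real.sqrt (energyMean u T) := by
  have h := hu.abs_timeMean_power_le isSmooth_kolForce hT
  rw [integral_norm_sq_kolForce] at h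
  exact h

/-- **Doering–Foias Cesàro energy bound** (`ν > 0`): `⟨‖u‖²⟩_T ≤ K` for all `T ≥ 1`, with a
constant depending on `ν`, the datum and the (conserved) momentum (the tree's
`Torus.IsGlobalLerayHopf.timeMean_norm_sq_le`). [cite: DoeringFoias2002, §2] -/
theorem exists_energyMean_le (hu : Torus.IsGlobalLerayHopf ν (fun _ => kolForce) u₀ u)
    (hν : 0 < ν) : ∃ K : ℝ, 0 ≤ K ∧ ∀ T, 1 ≤ T → energyMean u T ≤ K := by
  refine ⟨Torus.kineticEnergy u₀ / (2 * Real.pi ^ 2 * ν) +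
    (2 * ‖∫ x, u 1 x‖ ^ 2 + (∫ x, ‖kolForce x‖ ^ 2) / (16 * Real.pi ^ 4 * ν ^ 2)), ?_,
    fun T hT => hu.timeMean_norm_sq_le hν isSmooth_kolForce hasZeroMean_kolForce hT⟩
  have h1 : 0 ≤ Torus.kineticEnergy u₀ := Torus.kineticEnergy_nonneg _
  have h2 : 0 ≤ ∫ x, ‖kolForce x‖ ^ 2 := integral_nonneg fun _ => by positivity
  positivity

/-- **The boundary term of the Cesàro work identity vanishes**: for every `δ > 0`, eventually
`T⁻¹ |W(T) − W(0)| ≤ δ` — along EVERY global Leray–Hopf solution (`ν > 0`), with no hypothesis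
on the datum and no uniform-in-time energy hypothesis (`‖u(T)‖² ≤ ‖u₀‖² + O(T)` by
`lh_norm_sq_le`, `abs_powerMean_le`, `exists_energyMean_le`). [folklore] -/
theorem eventually_abs_boundary_le (hu : Torus.IsGlobalLerayHopf ν (fun _ => kolForce) u₀ u)
    (hν : 0 < ν) {δ : ℝ} (hδ : 0 < δ) :
    ∀ᶠ T : ℝ in atTop,
      |T⁻¹ * ((∫ x, ⟪kolForce x, u T x⟫_ℝ) - ∫ x, ⟪kolForce x, u₀ x⟫_ℝ)| ≤ δ := by
  obtain ⟨K, hK0, hK⟩ := exists_energyMean_le hu hν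
  set a : ℝ := ∫ x, ‖u₀ x‖ ^ 2 with ha_def
  set w₀ : ℝ := |∫ x, ⟪kolForce x, u₀ x⟫_ℝ| with hw₀
  set c : ℝ := 2 * (Real.sqrt (1 / 2) * Real.sqrt K) with hc_def
  have ha : 0 ≤ a := integral_nonneg fun _ => by positivity
  have hc : 0 ≤ c := by positivity
  have hw : 0 ≤ w₀ := abs_nonneg _
  have h1 : ∀ᶠ T : ℝ in atTop, w₀ ≤ δ / 2 * T := by
    filter_upwards [eventually_ge_atTop (2 * w₀ / δ)] with T hT
    calc w₀ = δ / 2 * (2 * w₀ / δ) := by field_simp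
      _ ≤ δ / 2 * T := mul_le_mul_of_nonneg_left hT (by positivity)
  have h2 : ∀ᶠ T : ℝ in atTop, Real.sqrt (1 / 2) * Real.sqrt (a + c * T) ≤ δ / 2 * T := by
    filter_upwards [eventually_ge_atTop (1 : ℝ), eventually_ge_atTop ((a + c) / (δ / 2) ^ 2)]
      with T hT1 hT2
    have h3 : a + c ≤ (δ / 2) ^ 2 * T := by
      have h := mul_le_mul_of_nonneg_left hT2 (by positivity : (0 : ℝ) ≤ (δ / 2) ^ 2)
      rwa [mul_div_cancel₀ _ (by positivity : ((δ : ℝ) / 2) ^ 2 ≠ 0)] at h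
    have hsq : a + c * T ≤ (δ / 2 * T) ^ 2 := by nlinarith
    calc Real.sqrt (1 / 2) * Real.sqrt (a + c * T) ≤ 1 * Real.sqrt (a + c * T) :=
          mul_le_mul_of_nonneg_right
            ((Real.sqrt_le_sqrt (by norm_num : (1 / 2 : ℝ) ≤ 1)).trans_eq Real.sqrt_one)
            (Real.sqrt_nonneg _)
      _ = Real.sqrt (a + c * T) := one_mul _
      _ ≤ Real.sqrt ((δ / 2 * T) ^ 2) := Real.sqrt_le_sqrt hsq
      _ = δ / 2 * T := Real.sqrt_sq (by positivity)
  filter_upwards [h1, h2, eventually_gt_atTop (0 : ℝ), eventually_ge_atTop (1 : ℝ)]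
    with T i1 i2 hT hT1
  have hE : ∫ x, ‖u T x‖ ^ 2 ≤ a + c * T := by
    have h := lh_norm_sq_le hu hν.le hT
    have hp : powerMean u T ≤ Real.sqrt (1 / 2) * Real.sqrt K :=
      (le_abs_self _).trans ((abs_powerMean_le hu hT).trans
        (mul_le_mul_of_nonneg_left (Real.sqrt_le_sqrt (hK T hT1)) (Real.sqrt_nonneg _)))
    have h' := mul_le_mul_of_nonneg_left hp (by positivity : (0 : ℝ) ≤ 2 * T)
    rw [hc_def]
    linarith
  have hW : |∫ x, ⟪kolForce x, u T x⟫_ℝ| ≤ Real.sqrt (1 / 2) * Real.sqrt (a + c * T) :=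
    (abs_work_le_L2 ((hu T hT).memLp T ⟨hT.le, le_rfl⟩)).trans
      (mul_le_mul_of_nonneg_left (Real.sqrt_le_sqrt hE) (Real.sqrt_nonneg _))
  have hA1 := le_abs_self (∫ x, ⟪kolForce x, u T x⟫_ℝ)
  have hA2 := neg_abs_le (∫ x, ⟪kolForce x, u T x⟫_ℝ)
  have hB1 := le_abs_self (∫ x, ⟪kolForce x, u₀ x⟫_ℝ)
  have hB2 := neg_abs_le (∫ x, ⟪kolForce x, u₀ x⟫_ℝ)
  have hW2 := hW.trans i2
  have hdiff : |(∫ x, ⟪kolForce x, u T x⟫_ℝ) - ∫ x, ⟪kolForce x, u₀ x⟫_ℝ| ≤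
      δ / 2 * T + δ / 2 * T :=
    abs_sub_le_iff.2 ⟨by linarith, by linarith⟩
  have hTinv : T⁻¹ * T = 1 := inv_mul_cancel₀ hT.ne'
  rw [abs_mul, abs_of_pos (inv_pos.2 hT)]
  calc T⁻¹ * |(∫ x, ⟪kolForce x, u T x⟫_ℝ) - ∫ x, ⟪kolForce x, u₀ x⟫_ℝ|
      ≤ T⁻¹ * (δ / 2 * T + δ / 2 * T) := mul_le_mul_of_nonneg_left hdiff (inv_pos.2 hT).le
    _ = δ := by linear_combination δ * hTinv

/-- The boundary term tends to zero. [folklore] -/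
theorem tendsto_boundary (hu : Torus.IsGlobalLerayHopf ν (fun _ => kolForce) u₀ u) (hν : 0 < ν) :
    Tendsto (fun T : ℝ => T⁻¹ * ((∫ x, ⟪kolForce x, u T x⟫_ℝ) - ∫ x, ⟪kolForce x, u₀ x⟫_ℝ))
      atTop (𝓝 0) := by
  rw [Metric.tendsto_nhds]
  intro δ hδ
  filter_upwards [eventually_abs_boundary_le hu hν (half_pos hδ)] with T hT
  rw [Real.dist_eq, sub_zero]
  exact hT.trans_lt (half_lt_self hδ)

/-- Eventual one-sided bounds on the Cesàro means without any energy hypothesis (`ν > 0`):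
for all large `T`, `|⟨W⟩_T| ≤ C = √(1/2)√K`, the boundary term is `≤ 1`, hence
`2π⟨A⟩_T ∈ [½ − 4π²ν√(1/2)√K − 1, ½ + 4π²ν√(1/2)√K + 1]`. [folklore] -/
theorem eventually_inphaseMean_crude_bounds
    (hu : Torus.IsGlobalLerayHopf ν (fun _ => kolForce) u₀ u) (hν : 0 < ν) :
    ∃ C : ℝ, ∀ᶠ T : ℝ in atTop, |powerMean u T| ≤ C ∧
      2 * Real.pi * inphaseMean u T ≤ 1 / 2 + 4 * Real.pi ^ 2 * ν * C + 1 ∧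
        1 / 2 - 4 * Real.pi ^ 2 * ν * C - 1 ≤ 2 * Real.pi * inphaseMean u T := by
  obtain ⟨K, hK0, hK⟩ := exists_energyMean_le hu hν
  refine ⟨Real.sqrt (1 / 2) * Real.sqrt K, ?_⟩
  have h4 : 0 < 4 * Real.pi ^ 2 * ν := by positivity
  filter_upwards [eventually_ge_atTop (1 : ℝ), eventually_abs_boundary_le hu hν one_pos]
    with T hT1 hb
  have hT : 0 < T := by linarith
  have hp : |powerMean u T| ≤ Real.sqrt (1 / 2) * Real.sqrt K :=
    (abs_powerMean_le hu hT).trans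
      (mul_le_mul_of_nonneg_left (Real.sqrt_le_sqrt (hK T hT1)) (Real.sqrt_nonneg _))
  refine ⟨hp, ?_⟩
  have e := powerMean_eq hu hT
  obtain ⟨p1, p2⟩ := abs_le.1 hp
  obtain ⟨b1, b2⟩ := abs_le.1 hb
  have q1 := mul_le_mul_of_nonneg_left p1 h4.le
  have q2 := mul_le_mul_of_nonneg_left p2 h4.le
  constructor <;> linarith

/-- **The mean injected power is read off the in-phase flux — hypothesis-free exact form.**
Along EVERY global Leray–Hopf weak solution of the Kolmogorov-forced system with `ν > 0` (no
further hypothesis): `meanPower f u = (½ − 2π · longTimeAvgInf A)/(4π²ν)`, i.e.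
`2πν · meanPower f u = 1/(4π) − liminf_T ⟨∫ u₁u₃ sin(2πx₃)⟩_T`. Since
`meanDissipation ν u ≤ meanPower f u` for Leray–Hopf solutions (tree, Doering–Foias 2002), the
`ZerothLaw` dissipation is bounded by the pinning defect of the in-phase flux, exactly.
[folklore] -/
theorem meanPower_kolForce_eq_inphase'
    (hu : Torus.IsGlobalLerayHopf ν (fun _ => kolForce) u₀ u) (hν : 0 < ν) :
    meanPower kolForce u =
      (1 / 2 - 2 * Real.pi * longTimeAvgInf (fun t => ∫ x, u t x 2 * ⟪kolSin x, u t x⟫_ℝ)) /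
        (4 * Real.pi ^ 2 * ν) := by
  change limsup (powerMean u) atTop =
    (1 / 2 - 2 * Real.pi * liminf (inphaseMean u) atTop) / (4 * Real.pi ^ 2 * ν)
  have hπ : 0 < 2 * Real.pi := by positivity
  have h4 : 0 < 4 * Real.pi ^ 2 * ν := by positivity
  set φ : ℝ → ℝ := fun a => (1 / 2 - 2 * Real.pi * a) / (4 * Real.pi ^ 2 * ν) with hφdef
  have hφ : Antitone φ := fun a b hab =>
    div_le_div_of_nonneg_right (by linarith [mul_le_mul_of_nonneg_left hab hπ.le]) h4.le
  have hφc : Continuous φ := (continuous_const.sub (continuous_const.mul continuous_id)).div_const _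
  obtain ⟨C, hC⟩ := eventually_inphaseMean_crude_bounds hu hν
  have hbA : IsBoundedUnder (· ≤ ·) atTop (inphaseMean u) := by
    refine isBoundedUnder_of_eventually_le
      (a := (1 / 2 + 4 * Real.pi ^ 2 * ν * C + 1) / (2 * Real.pi)) ?_
    filter_upwards [hC] with T hT
    rw [le_div_iff₀ hπ]
    linarith [hT.2.1]
  have hbA' : IsBoundedUnder (· ≥ ·) atTop (inphaseMean u) := by
    refine isBoundedUnder_of_eventually_ge
      (a := (1 / 2 - 4 * Real.pi ^ 2 * ν * C - 1) / (2 * Real.pi)) ?_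
    filter_upwards [hC] with T hT
    rw [div_le_iff₀ hπ]
    linarith [hT.2.2]
  have hbφ : IsBoundedUnder (· ≤ ·) atTop (fun T => φ (inphaseMean u T)) := by
    obtain ⟨a, ha⟩ := hbA'.eventually_ge
    exact isBoundedUnder_of_eventually_le (ha.mono fun T h => hφ h)
  have hbφ' : IsBoundedUnder (· ≥ ·) atTop (fun T => φ (inphaseMean u T)) := by
    obtain ⟨a, ha⟩ := hbA.eventually_le
    exact isBoundedUnder_of_eventually_ge (ha.mono fun T h => hφ h)
  -- the remainder
  set r : ℝ → ℝ := fun T =>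
    -(T⁻¹ * ((∫ x, ⟪kolForce x, u T x⟫_ℝ) - ∫ x, ⟪kolForce x, u₀ x⟫_ℝ)) /
      (4 * Real.pi ^ 2 * ν) with hrdef
  have hr : Tendsto r atTop (𝓝 0) := by
    have h := ((tendsto_boundary hu hν).neg).div_const (4 * Real.pi ^ 2 * ν)
    rwa [neg_zero, zero_div] at h
  have hdec : powerMean u =ᶠ[atTop] fun T => φ (inphaseMean u T) + r T := by
    filter_upwards [eventually_gt_atTop (0 : ℝ)] with T hT
    have e := powerMean_eq hu hT
    simp only [hφdef, hrdef]
    rw [← add_div, eq_div_iff h4.ne']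
    linarith
  rw [limsup_congr hdec]
  have h1 : limsup (fun T => φ (inphaseMean u T) + r T) atTop ≤
      limsup (fun T => φ (inphaseMean u T)) atTop + limsup r atTop :=
    limsup_add_le hbφ' hbφ hr.isBoundedUnder_ge.isCoboundedUnder_le hr.isBoundedUnder_le
  have h2 : limsup (fun T => φ (inphaseMean u T)) atTop + liminf r atTop ≤
      limsup (fun T => φ (inphaseMean u T) + r T) atTop :=
    le_limsup_add hbφ hbφ'.isCoboundedUnder_le hr.isBoundedUnder_le hr.isBoundedUnder_ge
  rw [hr.limsup_eq, add_zero] at h1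
  rw [hr.liminf_eq, add_zero] at h2
  rw [le_antisymm h1 h2]
  exact (hφ.map_liminf_of_continuousAt (inphaseMean u) hφc.continuousAt
    hbA.isCoboundedUnder_ge hbA').symm

/-- **A dissipation floor un-pins the in-phase flux — under `ZerothLaw`'s hypotheses only.**
Along every global Leray–Hopf weak solution of the Kolmogorov-forced system with `ν > 0` (no
further hypothesis): `ε ≤ meanDissipation ν u ⟹ longTimeAvgInf A ≤ (½ − 4π²νε)/(2π)`, i.e.
`liminf_T ⟨A⟩_T ≤ 1/(4π) − 2πνε`.
[folklore; cite: DoeringFoias2002, §2] -/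
theorem inphase_longTimeAvgInf_le_of_floor'
    (hu : Torus.IsGlobalLerayHopf ν (fun _ => kolForce) u₀ u) (hν : 0 < ν)
    {ε : ℝ} (hε : ε ≤ meanDissipation ν u) :
    longTimeAvgInf (fun t => ∫ x, u t x 2 * ⟪kolSin x, u t x⟫_ℝ) ≤
      (1 / 2 - 4 * Real.pi ^ 2 * ν * ε) / (2 * Real.pi) := by
  have hπ : 0 < 2 * Real.pi := by positivity
  have h4 : 0 < 4 * Real.pi ^ 2 * ν := by positivity
  have hP : ε ≤ meanPower kolForce u :=
    hε.trans (DoeringFoias2002_dissipation_le_power_holds hν (isSmooth_kolForce.memLp 2)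
      hasZeroMean_kolForce u₀ u hu)
  rw [meanPower_kolForce_eq_inphase' hu hν, le_div_iff₀ h4] at hP
  rw [le_div_iff₀ hπ]
  nlinarith [hP, Real.pi_pos]

/-- Pinning bounds from eventual two-sided control (bookkeeping: `∀ δ > 0`, eventually
`½ − c − δ ≤ 2π m(T) ≤ ½ + c + δ` implies `(½ − c)/(2π) ≤ liminf m` and `limsup m ≤ (½ + c)/(2π)`).
[folklore] -/
theorem pinning_of_eventually {m : ℝ → ℝ} {c : ℝ}
    (hev : ∀ δ : ℝ, 0 < δ → ∀ᶠ T in atTop,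
      2 * Real.pi * m T ≤ 1 / 2 + c + δ ∧ 1 / 2 - c - δ ≤ 2 * Real.pi * m T) :
    (1 / 2 - c) / (2 * Real.pi) ≤ liminf m atTop ∧
      limsup m atTop ≤ (1 / 2 + c) / (2 * Real.pi) := by
  have hπ : 0 < 2 * Real.pi := by positivity
  have hlow : ∀ᶠ T in atTop, (1 / 2 - c - 1) / (2 * Real.pi) ≤ m T := by
    filter_upwards [hev 1 one_pos] with T hT
    rw [div_le_iff₀ hπ]
    linarith [hT.2]
  have hup : ∀ᶠ T in atTop, m T ≤ (1 / 2 + c + 1) / (2 * Real.pi) := by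
    filter_upwards [hev 1 one_pos] with T hT
    rw [le_div_iff₀ hπ]
    linarith [hT.1]
  constructor
  · refine le_of_forall_pos_le_add fun ε hε => ?_
    have hlim : (1 / 2 - c) / (2 * Real.pi) - ε ≤ liminf m atTop := by
      refine le_liminf_of_le (isCoboundedUnder_ge_of_eventually_le atTop hup) ?_
      filter_upwards [hev (2 * Real.pi * ε) (by positivity)] with T hT
      calc (1 / 2 - c) / (2 * Real.pi) - ε = (1 / 2 - c - 2 * Real.pi * ε) / (2 * Real.pi) := by
            rw [sub_div _ (2 * Real.pi * ε), mul_div_cancel_left₀ ε hπ.ne']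
        _ ≤ m T := (div_le_iff₀ hπ).2 (by linarith [hT.2])
    linarith
  · refine le_of_forall_pos_le_add fun ε hε => ?_
    refine limsup_le_of_le (isCoboundedUnder_le_of_eventually_le atTop hlow) ?_
    filter_upwards [hev (2 * Real.pi * ε) (by positivity)] with T hT
    calc m T ≤ (1 / 2 + c + 2 * Real.pi * ε) / (2 * Real.pi) :=
          (le_div_iff₀ hπ).2 (by linarith [hT.1])
      _ = (1 / 2 + c) / (2 * Real.pi) + ε := by
          rw [add_div _ (2 * Real.pi * ε), mul_div_cancel_left₀ ε hπ.ne']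

/-- **Pinning from the `limsup` Cesàro energy bound of `ZerothLaw`.** Along every global
Leray–Hopf weak solution of the Kolmogorov-forced system with `ν > 0`:
`meanEnergy u ≤ E ⟹ (½ − 4π²ν√(1/2)√E)/(2π) ≤ longTimeAvgInf A ∧
longTimeAvgSup A ≤ (½ + 4π²ν√(1/2)√E)/(2π)` — the in-phase Reynolds-stress moment of every
`ZerothLaw`-admissible solution is `1/(4π) + O(ν√E)` in `liminf` and `limsup` of Cesàro means.
[folklore; cite: DoeringFoias2002, §2] -/
theorem inphase_longTimeAvg_bounds_of_meanEnergy
    (hu : Torus.IsGlobalLerayHopf ν (fun _ => kolForce) u₀ u) (hν : 0 < ν)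
    {E : ℝ} (hE : meanEnergy u ≤ E) :
    (1 / 2 - 4 * Real.pi ^ 2 * ν * (Real.sqrt (1 / 2) * Real.sqrt E)) / (2 * Real.pi) ≤
        longTimeAvgInf (fun t => ∫ x, u t x 2 * ⟪kolSin x, u t x⟫_ℝ) ∧
      longTimeAvgSup (fun t => ∫ x, u t x 2 * ⟪kolSin x, u t x⟫_ℝ) ≤
        (1 / 2 + 4 * Real.pi ^ 2 * ν * (Real.sqrt (1 / 2) * Real.sqrt E)) / (2 * Real.pi) := by
  change (1 / 2 - 4 * Real.pi ^ 2 * ν * (Real.sqrt (1 / 2) * Real.sqrt E)) / (2 * Real.pi) ≤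
        liminf (inphaseMean u) atTop ∧
      limsup (inphaseMean u) atTop ≤
        (1 / 2 + 4 * Real.pi ^ 2 * ν * (Real.sqrt (1 / 2) * Real.sqrt E)) / (2 * Real.pi)
  change limsup (energyMean u) atTop ≤ E at hE
  have h4 : 0 < 4 * Real.pi ^ 2 * ν := by positivity
  obtain ⟨K, hK0, hK⟩ := exists_energyMean_le hu hν
  have hbddE : IsBoundedUnder (· ≤ ·) atTop (energyMean u) :=
    isBoundedUnder_of_eventually_le ((eventually_ge_atTop (1 : ℝ)).mono hK)
  have hE0 : 0 ≤ E := by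
    refine le_trans (le_limsup_of_frequently_le (Eventually.frequently ?_) hbddE) hE
    filter_upwards [eventually_ge_atTop (0 : ℝ)] with T hT
    exact mul_nonneg (inv_nonneg.2 hT) (intervalIntegral.integral_nonneg hT fun t _ =>
      integral_nonneg fun _ => by positivity)
  refine pinning_of_eventually fun δ hδ => ?_
  set L : ℝ := 4 * Real.pi ^ 2 * ν * Real.sqrt (1 / 2) with hL
  have hL0 : 0 ≤ L := by positivity
  obtain ⟨η, hη0, hη⟩ : ∃ η : ℝ, 0 < η ∧ L * η ≤ δ / 2 :=
    ⟨δ / 2 / (L + 1), by positivity, by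
      calc L * (δ / 2 / (L + 1)) ≤ (L + 1) * (δ / 2 / (L + 1)) :=
            mul_le_mul_of_nonneg_right (by linarith) (by positivity)
        _ = δ / 2 := mul_div_cancel₀ _ (by positivity)⟩
  have hsqrt : ∀ᶠ T in atTop, Real.sqrt (energyMean u T) ≤ Real.sqrt E + η := by
    have hlt : limsup (energyMean u) atTop < (Real.sqrt E + η) ^ 2 := by
      have h : E < (Real.sqrt E + η) ^ 2 := by
        nlinarith [Real.sq_sqrt hE0, Real.sqrt_nonneg E]
      exact hE.trans_lt h
    filter_upwards [eventually_lt_of_limsup_lt hlt hbddE] with T hT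
    calc Real.sqrt (energyMean u T) ≤ Real.sqrt ((Real.sqrt E + η) ^ 2) := Real.sqrt_le_sqrt hT.le
      _ = Real.sqrt E + η := Real.sqrt_sq (by positivity)
  filter_upwards [hsqrt, eventually_abs_boundary_le hu hν (half_pos hδ),
    eventually_gt_atTop (0 : ℝ)] with T h1 h2 hT
  have e := powerMean_eq hu hT
  obtain ⟨p1, p2⟩ := abs_le.1 (abs_powerMean_le hu hT)
  obtain ⟨b1, b2⟩ := abs_le.1 h2
  have q1 := mul_le_mul_of_nonneg_left p1 h4.le
  have q2 := mul_le_mul_of_nonneg_left p2 h4.le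
  have q : 4 * Real.pi ^ 2 * ν * (Real.sqrt (1 / 2) * Real.sqrt (energyMean u T)) ≤
      L * Real.sqrt E + δ / 2 := by
    calc 4 * Real.pi ^ 2 * ν * (Real.sqrt (1 / 2) * Real.sqrt (energyMean u T))
        = L * Real.sqrt (energyMean u T) := by rw [hL]; ring
      _ ≤ L * (Real.sqrt E + η) := mul_le_mul_of_nonneg_left h1 hL0
      _ ≤ L * Real.sqrt E + δ / 2 := by rw [mul_add]; linarith
  have hLE : 4 * Real.pi ^ 2 * ν * (Real.sqrt (1 / 2) * Real.sqrt E) = L * Real.sqrt E := by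
    rw [hL]; ring
  constructor <;> linarith

/-- **`ZerothLaw`'s clauses pin the in-phase flux into an `O(ν)` window below `1/(4π)`.**
For every global Leray–Hopf weak solution of the Kolmogorov-forced system (`ν > 0`; nothing
else assumed) satisfying the two quantitative clauses of `ZerothLaw`, `meanEnergy u ≤ E` and
`ε ≤ meanDissipation ν u`:
`1/(4π) − 2πν√(1/2)√E ≤ liminf_T ⟨∫ u₁u₃ sin(2πx₃)⟩_T ≤ 1/(4π) − 2πνε`.
In particular `ε ≤ √(1/2)√E`, and along every `ZerothLaw` witness family `(ν_j → 0, u_j)` on this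
force the `liminf` Cesàro in-phase Reynolds-stress moment has a defect below the universal value
`1/(4π)` of order exactly `ν_j`, uniformly in `j` (the un-pinning half being equivalent to a floor
on `meanPower`). [folklore] -/
theorem zerothLaw_clauses_pin_inphase
    (hu : Torus.IsGlobalLerayHopf ν (fun _ => kolForce) u₀ u) (hν : 0 < ν)
    {E ε : ℝ} (hE : meanEnergy u ≤ E)
    (hε : ε ≤ meanDissipation ν u) :
    (1 / 2 - 4 * Real.pi ^ 2 * ν * (Real.sqrt (1 / 2) * Real.sqrt E)) / (2 * Real.pi) ≤
        longTimeAvgInf (fun t => ∫ x, u t x 2 * ⟪kolSin x, u t x⟫_ℝ) ∧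
      longTimeAvgInf (fun t => ∫ x, u t x 2 * ⟪kolSin x, u t x⟫_ℝ) ≤
        (1 / 2 - 4 * Real.pi ^ 2 * ν * ε) / (2 * Real.pi) :=
  ⟨(inphase_longTimeAvg_bounds_of_meanEnergy hu hν hE).1,
    inphase_longTimeAvgInf_le_of_floor' hu hν hε⟩

end Summit.AnomalousDissipation.AnomalousDissipation.Theorems
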